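import Summits.BirchSwinnertonDyer.BirchSwinnertonDyer.Theorems.SignedLowerHalvesSprungLowerDivisibilityAtThreeCokerBoundSkeleton
import HarnessLib

/-!
# Crux `SprungLowerDivisibilityAtThree` (item stmt-BirchSwinnertonDyer-19875; x8 children 22569 / 22901 / 22570 / 23112),
# line `chromatic-common-zeros`: the MASS SKELETON — pure module algebra behind (M1) «chromatic excess ≤ cotorsion»
# `min(ℓ_𝔭 X♯, ℓ_𝔭 X♭) ≤ ℓ_𝔭 X₀ + ℓ_𝔭 tors_Λ X(E/ℚ_∞)` from Poitou–Tate at `H¹_Iw(ℚ_p,T)`, the joint Coleman map, and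
# the DEFINITIONS of `Sel^•` / `Sel₀` as Selmer conditions at `p` (read through Pontryagin duality) — no colour map on `𝐇¹`

Cell `bsd-ssimc` (host), width seat `cruxlead-stmt-BirchSwinnertonDyer-19875-w2` (gen 9) under the 19875 LEAD; `--supports`
stmt-BirchSwinnertonDyer-22569 `--as helper`; theorems only; closes NO item. Companion of `…CokerBoundByMass` (this seat: the
registered stub F-α♮ ⟸ (MASS♮) ⟸ (M1) ∧ (M2), with (M2) = Wingberg/Matar typed as
`matar2020_thm11_selmerDualTorsion_pseudoIso_fineSelmerDual`) and of `…CokerBoundSkeleton` (w3 g6, p652444: the torsion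
bookkeeping `ℓ_𝔭 tors(R²/R·(a,b)) = min(ℓ_𝔭 R/(a), ℓ_𝔭 R/(b))` and `min(ℓ_𝔭 R/range cs, ℓ_𝔭 R/range cf) ≤ ℓ_𝔭 tors X`).
HONEST FRAMING: abstract modules over a UFD `R` (e.g. `Λ = ℤ_p⟦T⟧`); nothing arithmetic is asserted; the instantiation on the
tree's pinned objects (the typer's Poitou–Tate structure) is NOT done here; K_spor, S4b-cyc, K1, leaf X8 and BSD are NOT proved.

THE SKELETON (Kato (17.13.1) / Kobayashi 2003 (7.18)–(7.20), Prop. 7.1, Thm. 7.3; Sprung 2012 Def. 7.9 / 7.11 / 7.13). Data over `R`: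
* `H` = Kato's `𝐇¹`, CYCLIC `H = R·h₀` (Kato Thm. 12.4 (3)); `P` = `H¹_Iw(ℚ_p, T)` (tree: the functional model); `loc : H → P` with
  `loc h₀ ≠ 0` (Kato Thm. 12.4 (2) + weak Leopoldt: `𝐇¹ ↪ H¹_Iw`); `X` = `X(E/ℚ_∞) = Sel_{p^∞}(E/ℚ_∞)^∨`, `toX : P → X` with
  `Function.Exact loc toX` (Poitou–Tate at `H¹_Iw(ℚ_p,T)`);
* `Y` = `X₀ = Sel₀^∨` with `πY : X ↠ Y`, `ker πY = range toX` (dual of `0 → Sel₀ → Sel → H¹(ℚ_{∞,p}, E[p^∞]) = E(ℚ_{∞,p}) ⊗ ℚ_p/ℤ_p`,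
  Kobayashi Lemma 7.10 / (7.18); Sprung Def. 7.13);
* `J : P ↪ R × R` the JOINT Coleman map `(Col♯, Col♭)`, injective with `ℓ_𝔭(R²/range J) = 0` (IN TREE:
  `Sprung2012.exists_linearMap_isColemanPair_cokernel_of_hondaSystem_rat`, cokernel `Λ/(T)`);
* `D♯, D♭` = `X♯, X♭ = (Sel^•)^∨` with `π• : X ↠ D•`, `ker π• = toX(Ker Col^•)`, `Ker Col♯ = ker(fst ∘ J)`, `Ker Col♭ = ker(snd ∘ J)`
  (dual of `Sel^• = Ker(Sel → (E(ℚ_{∞,𝔭}) ⊗ ℚ_p/ℤ_p)/E^•_{∞,𝔭})`, `E^•` = exact annihilator of `Ker Col^•`, Sprung Def. 7.9 / 7.11).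
THEN (§2, `min_lengthAt_le_fine_add_torsion_of_massSkeleton`) at every height-one `𝔭`:
`min(ℓ_𝔭 D♯, ℓ_𝔭 D♭) ≤ ℓ_𝔭 Y + ℓ_𝔭(tors X)` — hypothesis (M1) of `massIota_of_cotorsion_of_fine`, with NO non-vanishing condition
on either colour (if `Col♯(loc h₀) = 0` the ♭-colour carries the bound, §1 `lengthAt_quotient_span_le_torsion_pair_snd/fst`).
Route: `ℓ_𝔭 D• ≤ ℓ_𝔭 range(π• ∘ toX) + ℓ_𝔭 Y` (`Y ↠ D•/range(π• ∘ toX)`); `range(π• ∘ toX) ≅ P/(Ker Col^• ⊔ range loc)`;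
`ℓ_𝔭 P/(ker c• ⊔ range loc) = ℓ_𝔭 R/(c•(loc h₀))` (`c♯ = fst ∘ J`, cokernel of `c•` of length `0`); then w3's torsion bookkeeping.

References: [Kato2004Asterisque] Thm. 12.4 (p. 221), (17.13.1) (pp. 279–280); [Kobayashi2003] Lemma 7.10?—Prop. 7.1, (7.16)–(7.20),
Thm. 7.3 (pp. 12–13); [Sprung2012] Def. 7.9, 7.11 (p. 1503), Def. 7.13, Thm. 7.14 (3) (p. 1504), §7.1 Props. 7.3/7.6;
[KuriharaPollack2007] Prop. 1.2; [LeiSujatha2021] (SES-KP), (PT); [Washington1997] §13.2; [BourbakiAC5to7] VII §4.4–4.5; tree: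
`…CokerBoundSkeleton` (p652444), `…CokerBoundByMass` (this seat), `IwasawaAlgebra{CharIdeal,Divisibility}Proofs`.
-/

set_option linter.dupNamespace false
set_option autoImplicit false

noncomputable section

open scoped Classical

open Literature.NumberTheory.EllipticCurves Literature.NumberTheory.EllipticCurves.Module
  Summit.BirchSwinnertonDyer.BirchSwinnertonDyer.Theorems.SmallImageSignedMuDefect

namespace Summit.BirchSwinnertonDyer.BirchSwinnertonDyer.Theorems.ChromaticCommonZeros

/-! ### §1 Pure algebra: lengths through the Poitou–Tate maps; the one-colour torsion bound -/

section MassAlgebra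

variable {R : Type*} [CommRing R]
  {H P X Y D : Type*} [AddCommGroup H] [Module R H] [AddCommGroup P] [Module R P] [AddCommGroup X] [Module R X]
  [AddCommGroup Y] [Module R Y] [AddCommGroup D] [Module R D]

/-- **`ℓ_𝔭 D ≤ ℓ_𝔭 range(π_D ∘ toX) + ℓ_𝔭 Y`** for surjections `π_D : X ↠ D`, `π_Y : X ↠ Y` with `ker π_Y = range toX`: the
quotient `D / π_D(toX P)` is a quotient of `X / toX P ≅ Y`. (Dual Selmer reading: `X^•` modulo the image of the local
Iwasawa cohomology is a quotient of `X₀`.) [folklore] [cite: BourbakiAC5to7, VII §4.5 Prop. 10] -/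
theorem lengthAt_le_range_comp_add_of_ker_eq_range (toX : P →ₗ[R] X) (πD : X →ₗ[R] D)
    (hπD : Function.Surjective πD) (πY : X →ₗ[R] Y) (hπY : Function.Surjective πY)
    (hkerY : LinearMap.ker πY = LinearMap.range toX) (𝔭 : PrimeSpectrum R) :
    Module.lengthAt R D 𝔭 ≤ Module.lengthAt R (LinearMap.range (πD ∘ₗ toX)) 𝔭 + Module.lengthAt R Y 𝔭 := by
  set N : Submodule R D := LinearMap.range (πD ∘ₗ toX) with hN
  rw [lengthAt_eq_add_quotient N 𝔭]
  refine add_le_add le_rfl ?_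
  have hle : LinearMap.ker πY ≤ LinearMap.ker (N.mkQ ∘ₗ πD) := by
    rw [hkerY]
    rintro _ ⟨z, rfl⟩
    rw [LinearMap.mem_ker, LinearMap.comp_apply, Submodule.mkQ_apply, Submodule.Quotient.mk_eq_zero, hN]
    exact ⟨z, rfl⟩
  have hsurj : Function.Surjective ((LinearMap.ker πY).liftQ (N.mkQ ∘ₗ πD) hle) := by
    rw [← LinearMap.range_eq_top, Submodule.range_liftQ, LinearMap.range_eq_top]
    exact (Submodule.mkQ_surjective N).comp hπD
  set ψ : Y →ₗ[R] D ⧸ N := ((LinearMap.ker πY).liftQ (N.mkQ ∘ₗ πD) hle) ∘ₗ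
    ((πY.quotKerEquivOfSurjective hπY).symm : Y →ₗ[R] X ⧸ LinearMap.ker πY) with hψ
  have hψsurj : Function.Surjective ψ := by
    rw [hψ, LinearMap.coe_comp]
    exact hsurj.comp (πY.quotKerEquivOfSurjective hπY).symm.surjective
  exact lengthAt_le_of_surjective ψ hψsurj 𝔭

/-- **`range(π_D ∘ toX) ≅ P / (K ⊔ range loc)`** when `ker π_D = toX(K)` and `loc, toX` are exact at `P`: in lengths,
`ℓ_𝔭 range(π_D ∘ toX) = ℓ_𝔭 P/(K ⊔ range loc)`. (Reading: `K = Ker Col^•`, so `X^• ⊇ π_•(toX P) ≅ H¹_Iw/(Ker Col^• + loc 𝐇¹)`.)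
[folklore] [cite: Sprung2012, Def. 7.9 and 7.11 (p. 1503)] -/
theorem lengthAt_range_comp_eq_of_ker_eq_map (loc : H →ₗ[R] P) (toX : P →ₗ[R] X) (hexact : Function.Exact loc toX)
    (πD : X →ₗ[R] D) (K : Submodule R P) (hkerD : LinearMap.ker πD = K.map toX) (𝔭 : PrimeSpectrum R) :
    Module.lengthAt R (LinearMap.range (πD ∘ₗ toX)) 𝔭 = Module.lengthAt R (P ⧸ (K ⊔ LinearMap.range loc)) 𝔭 := by
  have hker : LinearMap.ker (πD ∘ₗ toX) = K ⊔ LinearMap.range loc := by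
    rw [LinearMap.ker_comp, hkerD, Submodule.comap_map_eq, LinearMap.exact_iff.mp hexact]
  rw [← lengthAt_eq_of_linearEquiv (πD ∘ₗ toX).quotKerEquivRange 𝔭, hker]

/-- **`ℓ_𝔭 P/(ker c ⊔ range loc) = ℓ_𝔭 R/(c(loc h₀))`** for a functional `c : P → R` whose cokernel has length `0` at `𝔭` and
`H = R·h₀` cyclic: `c` identifies `P/(ker c ⊔ loc H)` with `c(P)/R·c(loc h₀) ⊆ R/(c(loc h₀))`, of colength `ℓ_𝔭(R/c(P)) = 0`.
(Reading: `c = Col^•` on `H¹_Iw`, so `ℓ_𝔭 X^• − ℓ_𝔭 X₀ = ord_𝔭 Col^•(loc h₀)` off the cokernel's support.)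
[folklore] [cite: Sprung2012, §7.1 Props. 7.3/7.6 (pp. 1500–1501)] -/
theorem lengthAt_quotient_ker_sup_range_eq (loc : H →ₗ[R] P) (c : P →ₗ[R] R) (h₀ : H)
    (hcyc : ∀ h : H, ∃ r : R, r • h₀ = h) (𝔭 : PrimeSpectrum R)
    (hc : Module.lengthAt R (R ⧸ LinearMap.range c) 𝔭 = 0) :
    Module.lengthAt R (P ⧸ (LinearMap.ker c ⊔ LinearMap.range loc)) 𝔭 =
      Module.lengthAt R (R ⧸ Ideal.span {c (loc h₀)}) 𝔭 := by
  set a : R := c (loc h₀) with ha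
  set I : Submodule R R := Ideal.span {a} with hI
  -- `φ = mk ∘ c : P → R/(a)` has kernel `ker c ⊔ range loc`
  set φ : P →ₗ[R] R ⧸ I := I.mkQ ∘ₗ c with hφ
  have hkerφ : LinearMap.ker φ = LinearMap.ker c ⊔ LinearMap.range loc := by
    apply le_antisymm
    · intro z hz
      rw [LinearMap.mem_ker, hφ, LinearMap.comp_apply, Submodule.mkQ_apply, Submodule.Quotient.mk_eq_zero, hI,
        Ideal.mem_span_singleton'] at hz
      obtain ⟨r, hr⟩ := hz
      -- `c z = r a = c (r • loc h₀)`
      have hz' : z - r • loc h₀ ∈ LinearMap.ker c := by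
        rw [LinearMap.mem_ker, map_sub, map_smul, smul_eq_mul, ← ha, hr, sub_self]
      have : z = (z - r • loc h₀) + loc (r • h₀) := by rw [map_smul]; abel
      rw [this]
      exact Submodule.add_mem_sup hz' (LinearMap.mem_range_self loc _)
    · refine sup_le (fun z hz => ?_) ?_
      · rw [LinearMap.mem_ker] at hz
        rw [LinearMap.mem_ker, hφ, LinearMap.comp_apply, hz, map_zero]
      · rintro _ ⟨h, rfl⟩
        obtain ⟨r, rfl⟩ := hcyc h
        have hca : c (loc (r • h₀)) = r * a := by rw [map_smul, map_smul, smul_eq_mul]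
        rw [LinearMap.mem_ker, hφ, LinearMap.comp_apply, hca, Submodule.mkQ_apply, Submodule.Quotient.mk_eq_zero, hI]
        exact Ideal.mul_mem_left _ r (Ideal.mem_span_singleton_self a)
  -- `range φ = (range c).map mk`, and `(R/(a)) / range φ ≅ R / range c`
  have hIle : I ≤ LinearMap.range c := by
    rw [hI, Ideal.span_singleton_le_iff_mem]
    exact ⟨loc h₀, rfl⟩
  have hrange : LinearMap.range φ = (LinearMap.range c).map I.mkQ := by rw [hφ, LinearMap.range_comp]
  have h1 := lengthAt_eq_add_quotient (LinearMap.range φ) 𝔭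
  rw [← lengthAt_eq_of_linearEquiv φ.quotKerEquivRange 𝔭, hkerφ, hrange,
    lengthAt_eq_of_linearEquiv (Submodule.quotientQuotientEquivQuotient I (LinearMap.range c) hIle) 𝔭, hc,
    add_zero] at h1
  exact h1.symm

/-- The cokernel of a coordinate of `J` is a quotient of the cokernel of `J`: `ℓ_𝔭 R/range(q ∘ J) ≤ ℓ_𝔭 R²/range J` for a
SURJECTIVE `q : R × R → R` (used with `q = fst, snd`). [folklore] -/
theorem lengthAt_quotient_range_comp_le (J : P →ₗ[R] R × R) (q : R × R →ₗ[R] R) (hq : Function.Surjective q)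
    (𝔭 : PrimeSpectrum R) :
    Module.lengthAt R (R ⧸ LinearMap.range (q ∘ₗ J)) 𝔭 ≤ Module.lengthAt R ((R × R) ⧸ LinearMap.range J) 𝔭 := by
  have hle : LinearMap.range J ≤ (LinearMap.range (q ∘ₗ J)).comap q := by
    rintro _ ⟨z, rfl⟩
    exact ⟨z, rfl⟩
  refine lengthAt_le_of_surjective (Submodule.mapQ _ _ q hle) ?_ 𝔭
  rw [← LinearMap.range_eq_top, Submodule.mapQ, Submodule.range_liftQ]
  exact LinearMap.range_eq_top.mpr ((Submodule.mkQ_surjective _).comp hq)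

variable [IsDomain R]

/-- **One-colour torsion bound, `♭`-coordinate:** for `b ≠ 0`, `R/(b)` embeds into the torsion of `R²/R·(0, b)`
(`r ↦ [(0, r)]`), so `ℓ_𝔭 R/(b) ≤ ℓ_𝔭 tors(R²/R·(0,b))`. (The case `Col♯(loc h₀) = 0` of the mass skeleton.) [folklore] -/
theorem lengthAt_quotient_span_le_torsion_pair_snd {b : R} (hb : b ≠ 0) (𝔭 : PrimeSpectrum R) :
    Module.lengthAt R (R ⧸ Ideal.span {b}) 𝔭 ≤
      Module.lengthAt R (Submodule.torsion R ((R × R) ⧸ Submodule.span R {((0, b) : R × R)})) 𝔭 := by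
  set N : Submodule R (R × R) := Submodule.span R {((0, b) : R × R)} with hN
  set φ : R →ₗ[R] (R × R) ⧸ N := N.mkQ ∘ₗ LinearMap.inr R R R with hφ
  have hker : LinearMap.ker φ = Ideal.span {b} := by
    ext r
    rw [LinearMap.mem_ker, hφ, LinearMap.comp_apply, LinearMap.inr_apply, Submodule.mkQ_apply,
      Submodule.Quotient.mk_eq_zero, hN, Submodule.mem_span_singleton, Ideal.mem_span_singleton']
    constructor
    · rintro ⟨s, hs⟩
      rw [Prod.smul_mk, smul_eq_mul, smul_eq_mul, mul_zero, Prod.mk.injEq] at hs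
      exact ⟨s, hs.2⟩
    · rintro ⟨s, rfl⟩
      exact ⟨s, by rw [Prod.smul_mk, smul_eq_mul, smul_eq_mul, mul_zero]⟩
  have htors : ∀ r : R, φ r ∈ Submodule.torsion R ((R × R) ⧸ N) := by
    intro r
    refine (Submodule.mem_torsion_iff _).mpr ⟨⟨b, mem_nonZeroDivisors_of_ne_zero hb⟩, ?_⟩
    rw [Submonoid.smul_def, hφ, LinearMap.comp_apply, LinearMap.inr_apply, Submodule.mkQ_apply,
      ← Submodule.Quotient.mk_smul, Submodule.Quotient.mk_eq_zero, hN, Submodule.mem_span_singleton]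
    exact ⟨r, by rw [Prod.smul_mk, Prod.smul_mk, smul_eq_mul, smul_eq_mul, smul_eq_mul, smul_eq_mul, mul_zero,
      mul_zero, mul_comm]⟩
  -- `R/(b) ↪ tors` through `φ`
  set ψ : R →ₗ[R] Submodule.torsion R ((R × R) ⧸ N) := LinearMap.codRestrict _ φ htors with hψ
  have hkerψ : LinearMap.ker ψ = Ideal.span {b} := by rw [hψ, LinearMap.ker_codRestrict, hker]
  set g : (R ⧸ Ideal.span {b}) →ₗ[R] Submodule.torsion R ((R × R) ⧸ N) := (Ideal.span {b}).liftQ ψ hkerψ.ge with hg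
  have hginj : Function.Injective g := by
    rw [← LinearMap.ker_eq_bot, hg]
    exact Submodule.ker_liftQ_eq_bot _ _ _ hkerψ.le
  exact lengthAt_le_of_injective g hginj 𝔭

/-- **One-colour torsion bound, `♯`-coordinate:** for `a ≠ 0`, `ℓ_𝔭 R/(a) ≤ ℓ_𝔭 tors(R²/R·(a,0))` (swap the coordinates in
`lengthAt_quotient_span_le_torsion_pair_snd`). [folklore] -/
theorem lengthAt_quotient_span_le_torsion_pair_fst {a : R} (ha : a ≠ 0) (𝔭 : PrimeSpectrum R) :
    Module.lengthAt R (R ⧸ Ideal.span {a}) 𝔭 ≤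
      Module.lengthAt R (Submodule.torsion R ((R × R) ⧸ Submodule.span R {((a, 0) : R × R)})) 𝔭 := by
  set N : Submodule R (R × R) := Submodule.span R {((a, 0) : R × R)} with hN
  set N' : Submodule R (R × R) := Submodule.span R {((0, a) : R × R)} with hN'
  have hmap : N.map (LinearEquiv.prodComm R R R : R × R →ₗ[R] R × R) = N' := by
    rw [hN, Submodule.map_span, Set.image_singleton]
    rfl
  have e : ((R × R) ⧸ N) ≃ₗ[R] ((R × R) ⧸ N') := Submodule.Quotient.equiv N N' (LinearEquiv.prodComm R R R) hmap
  rw [lengthAt_torsion_eq_of_linearEquiv e 𝔭, hN']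
  exact lengthAt_quotient_span_le_torsion_pair_snd ha 𝔭

omit [IsDomain R] in
/-- **The torsion of `R²/R·J(loc h₀)` is bounded by the torsion of `X`** (Poitou–Tate exact at `P`, `J` injective with cokernel
of length `0` at `𝔭`, `H = R·h₀`): `P/loc H ↪ R²/R·J(loc h₀)` with cokernel a quotient of `R²/range J`, and `P/loc H ≅ toX(P) ⊆ X`.
The torsion chain inside `min_lengthAt_quotient_range_le_lengthAt_torsion_of_skeleton` (p652444), exposed as a lemma.
[folklore] [cite: Kato2004Asterisque, (17.13.1) (p. 280)] [cite: KuriharaPollack2007, Prop. 1.2] -/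
theorem lengthAt_torsion_pair_quotient_le_torsion (loc : H →ₗ[R] P) (toX : P →ₗ[R] X) (hexact : Function.Exact loc toX)
    (J : P →ₗ[R] R × R) (hJ : Function.Injective J) (h₀ : H) (hcyc : ∀ h : H, ∃ r : R, r • h₀ = h)
    (𝔭 : PrimeSpectrum R) (hcoker : Module.lengthAt R ((R × R) ⧸ LinearMap.range J) 𝔭 = 0) :
    Module.lengthAt R (Submodule.torsion R ((R × R) ⧸ Submodule.span R {J (loc h₀)})) 𝔭 ≤
      Module.lengthAt R (Submodule.torsion R X) 𝔭 := by
  set v₀ : R × R := J (loc h₀) with hv₀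
  set N : Submodule R (R × R) := Submodule.span R {v₀} with hN
  have hJrange : (LinearMap.range loc).map J = N := by
    have htop : (⊤ : Submodule R H) = Submodule.span R {h₀} := by
      refine le_antisymm (fun h _ => ?_) le_top
      obtain ⟨r, rfl⟩ := hcyc h
      exact Submodule.smul_mem _ r (Submodule.mem_span_singleton_self h₀)
    rw [LinearMap.range_eq_map, htop, Submodule.map_span, Set.image_singleton, Submodule.map_span,
      Set.image_singleton]
  have hcomap : (N.comap J) = LinearMap.range loc := by
    rw [← hJrange, Submodule.comap_map_eq_of_injective hJ]
  have hle : LinearMap.range loc ≤ N.comap J := hcomap.ge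
  set ψ : (P ⧸ LinearMap.range loc) →ₗ[R] (R × R) ⧸ N := Submodule.mapQ _ N J hle with hψ
  have hψinj : Function.Injective ψ := by
    rw [← LinearMap.ker_eq_bot, hψ, Submodule.ker_mapQ, hcomap, Submodule.mkQ_map_self]
  have hψrange : LinearMap.range ψ = (LinearMap.range J).map N.mkQ := by
    rw [hψ]
    unfold Submodule.mapQ
    rw [Submodule.range_liftQ, LinearMap.range_comp]
  have hNle : N ≤ LinearMap.range J := by
    rw [hN, Submodule.span_singleton_le_iff_mem, hv₀]
    exact LinearMap.mem_range_self J _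
  have hcoker' : Module.lengthAt R (((R × R) ⧸ N) ⧸ LinearMap.range ψ) 𝔭 = 0 := by
    rw [hψrange, lengthAt_eq_of_linearEquiv (Submodule.quotientQuotientEquivQuotient N _ hNle) 𝔭, hcoker]
  have hker : LinearMap.ker toX = LinearMap.range loc := LinearMap.exact_iff.mp hexact
  set g : (P ⧸ LinearMap.range loc) →ₗ[R] X := (LinearMap.range loc).liftQ toX hker.ge with hg
  have hginj : Function.Injective g := by
    rw [← LinearMap.ker_eq_bot, hg]
    exact Submodule.ker_liftQ_eq_bot _ _ _ hker.le
  calc Module.lengthAt R (Submodule.torsion R ((R × R) ⧸ N)) 𝔭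
      ≤ Module.lengthAt R (Submodule.torsion R (P ⧸ LinearMap.range loc)) 𝔭 +
          Module.lengthAt R (((R × R) ⧸ N) ⧸ LinearMap.range ψ) 𝔭 :=
        lengthAt_torsion_le_add_of_injective ψ hψinj 𝔭
    _ = Module.lengthAt R (Submodule.torsion R (P ⧸ LinearMap.range loc)) 𝔭 := by rw [hcoker', add_zero]
    _ ≤ Module.lengthAt R (Submodule.torsion R X) 𝔭 := lengthAt_torsion_le_of_injective g hginj 𝔭

end MassAlgebra

/-! ### §2 The mass skeleton: (M1) from Poitou–Tate, the joint Coleman map and the Selmer conditions at `p` -/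

section MassSkeleton

variable {R : Type*} [CommRing R] [IsDomain R] [UniqueFactorizationMonoid R]
  {H P X Y Ds Df : Type*} [AddCommGroup H] [Module R H] [AddCommGroup P] [Module R P] [AddCommGroup X] [Module R X]
  [AddCommGroup Y] [Module R Y] [AddCommGroup Ds] [Module R Ds] [AddCommGroup Df] [Module R Df]

/-- **THE MASS SKELETON — hypothesis (M1) of `massIota_of_cotorsion_of_fine` over abstract modules.** Data (module docstring):
`H = R·h₀` cyclic, `loc : H → P` with `loc h₀ ≠ 0`, `toX : P → X` exact at `P` (Poitou–Tate), `πY : X ↠ Y` with `ker πY = range toX`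
(`X₀` = `X` modulo the local classes), the joint Coleman map `J : P ↪ R²` with `ℓ_𝔭(R²/range J) = 0`, and the chromatic duals
`π• : X ↠ D•` with `ker π• = toX(ker(•-coordinate of J))` (`Sel^•` cut out of `Sel` by the exact annihilator of `Ker Col^•`).
THEN at the height-one prime `𝔭`: `min(ℓ_𝔭 D♯, ℓ_𝔭 D♭) ≤ ℓ_𝔭 Y + ℓ_𝔭(tors X)` — NO non-vanishing hypothesis on either colour.
Proof: `ℓ_𝔭 D• ≤ ℓ_𝔭 R/(a•) + ℓ_𝔭 Y` with `(a♯, a♭) = J(loc h₀) ≠ 0` (§1), and `min(ℓ_𝔭 R/(a♯), ℓ_𝔭 R/(a♭)) ≤ ℓ_𝔭 tors(R²/R·(a♯,a♭))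
≤ ℓ_𝔭 tors X` (`lengthAt_torsion_quotient_span_pair_eq_min` when both are non-zero, the one-colour bounds otherwise;
`lengthAt_torsion_pair_quotient_le_torsion`). [cite: Kato2004Asterisque, Thm. 12.4 (p. 221), (17.13.1) (p. 280)]
[cite: Kobayashi2003, Prop. 7.1 and Thm. 7.3 (pp. 12–13)] [cite: Sprung2012, Def. 7.9, 7.11 (p. 1503), Def. 7.13 (p. 1504), §7.1 Props. 7.3/7.6]
[cite: KuriharaPollack2007, Prop. 1.2] [cite: LeiSujatha2021, (SES-KP), (PT)] -/
theorem min_lengthAt_le_fine_add_torsion_of_massSkeleton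
    (loc : H →ₗ[R] P) (toX : P →ₗ[R] X) (hexact : Function.Exact loc toX)
    (J : P →ₗ[R] R × R) (hJ : Function.Injective J)
    (πY : X →ₗ[R] Y) (hπY : Function.Surjective πY) (hkerY : LinearMap.ker πY = LinearMap.range toX)
    (πs : X →ₗ[R] Ds) (hπs : Function.Surjective πs)
    (hkers : LinearMap.ker πs = (LinearMap.ker (LinearMap.fst R R R ∘ₗ J)).map toX)
    (πf : X →ₗ[R] Df) (hπf : Function.Surjective πf)
    (hkerf : LinearMap.ker πf = (LinearMap.ker (LinearMap.snd R R R ∘ₗ J)).map toX)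
    (h₀ : H) (hcyc : ∀ h : H, ∃ r : R, r • h₀ = h) (hloc : loc h₀ ≠ 0)
    (𝔭 : PrimeSpectrum R) (h𝔭 : 𝔭.asIdeal.height = 1)
    (hcoker : Module.lengthAt R ((R × R) ⧸ LinearMap.range J) 𝔭 = 0) :
    min (Module.lengthAt R Ds 𝔭) (Module.lengthAt R Df 𝔭) ≤
      Module.lengthAt R Y 𝔭 + Module.lengthAt R (Submodule.torsion R X) 𝔭 := by
  -- the two coordinates of `v₀ = J (loc h₀)`
  set cs : P →ₗ[R] R := LinearMap.fst R R R ∘ₗ J with hcs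
  set cf : P →ₗ[R] R := LinearMap.snd R R R ∘ₗ J with hcf
  set a : R := cs (loc h₀) with ha
  set b : R := cf (loc h₀) with hb
  have hv₀ : J (loc h₀) = (a, b) := Prod.ext rfl rfl
  have hv₀ne : J (loc h₀) ≠ 0 := fun h => hloc (hJ (by rw [h, map_zero]))
  -- cokernels of the coordinates have length `0`
  have hcs0 : Module.lengthAt R (R ⧸ LinearMap.range cs) 𝔭 = 0 :=
    nonpos_iff_eq_zero.mp ((lengthAt_quotient_range_comp_le J _ Prod.fst_surjective 𝔭).trans hcoker.le)
  have hcf0 : Module.lengthAt R (R ⧸ LinearMap.range cf) 𝔭 = 0 :=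
    nonpos_iff_eq_zero.mp ((lengthAt_quotient_range_comp_le J _ Prod.snd_surjective 𝔭).trans hcoker.le)
  -- `ℓ D• ≤ ℓ R/(a•) + ℓ Y`
  have hDs : Module.lengthAt R Ds 𝔭 ≤ Module.lengthAt R (R ⧸ Ideal.span {a}) 𝔭 + Module.lengthAt R Y 𝔭 := by
    have h1 := lengthAt_le_range_comp_add_of_ker_eq_range toX πs hπs πY hπY hkerY 𝔭
    rwa [lengthAt_range_comp_eq_of_ker_eq_map loc toX hexact πs _ hkers 𝔭,
      lengthAt_quotient_ker_sup_range_eq loc cs h₀ hcyc 𝔭 hcs0] at h1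
  have hDf : Module.lengthAt R Df 𝔭 ≤ Module.lengthAt R (R ⧸ Ideal.span {b}) 𝔭 + Module.lengthAt R Y 𝔭 := by
    have h1 := lengthAt_le_range_comp_add_of_ker_eq_range toX πf hπf πY hπY hkerY 𝔭
    rwa [lengthAt_range_comp_eq_of_ker_eq_map loc toX hexact πf _ hkerf 𝔭,
      lengthAt_quotient_ker_sup_range_eq loc cf h₀ hcyc 𝔭 hcf0] at h1
  have htors := lengthAt_torsion_pair_quotient_le_torsion loc toX hexact J hJ h₀ hcyc 𝔭 hcoker
  rw [hv₀] at htors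
  -- `min(ℓ R/(a), ℓ R/(b)) ≤ ℓ tors(R²/R·(a,b))`, in all cases
  have hmin : min (Module.lengthAt R (R ⧸ Ideal.span {a}) 𝔭) (Module.lengthAt R (R ⧸ Ideal.span {b}) 𝔭) ≤
      Module.lengthAt R (Submodule.torsion R ((R × R) ⧸ Submodule.span R {((a, b) : R × R)})) 𝔭 := by
    by_cases ha0 : a = 0
    · have hb0 : b ≠ 0 := by
        rintro hb0
        exact hv₀ne (by rw [hv₀, ha0, hb0]; rfl)
      rw [ha0]
      exact (min_le_right _ _).trans (lengthAt_quotient_span_le_torsion_pair_snd hb0 𝔭)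
    by_cases hb0 : b = 0
    · rw [hb0]
      exact (min_le_left _ _).trans (lengthAt_quotient_span_le_torsion_pair_fst ha0 𝔭)
    exact (lengthAt_torsion_quotient_span_pair_eq_min a b ha0 hb0 𝔭 h𝔭).ge
  calc min (Module.lengthAt R Ds 𝔭) (Module.lengthAt R Df 𝔭)
      ≤ min (Module.lengthAt R (R ⧸ Ideal.span {a}) 𝔭 + Module.lengthAt R Y 𝔭)
          (Module.lengthAt R (R ⧸ Ideal.span {b}) 𝔭 + Module.lengthAt R Y 𝔭) := min_le_min hDs hDf
    _ = min (Module.lengthAt R (R ⧸ Ideal.span {a}) 𝔭) (Module.lengthAt R (R ⧸ Ideal.span {b}) 𝔭) +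
          Module.lengthAt R Y 𝔭 := min_add_add_right _ _ _
    _ ≤ Module.lengthAt R (Submodule.torsion R X) 𝔭 + Module.lengthAt R Y 𝔭 := add_le_add (hmin.trans htors) le_rfl
    _ = Module.lengthAt R Y 𝔭 + Module.lengthAt R (Submodule.torsion R X) 𝔭 := add_comm _ _

end MassSkeleton

end Summit.BirchSwinnertonDyer.BirchSwinnertonDyer.Theorems.ChromaticCommonZeros

end
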